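import Mathlib
import HarnessLib
import Summits.AtomisticToContinuum.Crystallization.Theorems.PricedLinkCensusSoftLayerPropagationStubBallPropagationLayersUp

/-!
# Local layer-propagation lemmas for the finite-ball form of Hales, *Dense Sphere Packings* §1.3 (XI):
# the layers below the base, by reflection

Route `PricedLinkCensus`, crux `SoftLayerPropagation` (stmt-AtomisticToContinuum-14233), line
`Sketch`, eleventh helper file for the stub `stub_ballPropagation` (uses `…Recursion.lean`).

`layers_up` certifies the layers ABOVE a certified base disc.  The layers BELOW are the layers
above for the packing reflected in the base plane: the reflection `R` in the plane `(ℝ 𝗁e₃)ᗮ`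
fixes the layer lattice, the hexagon and the hole points, exchanges `t + 𝗁e₃` and `t − 𝗁e₃`, hence
exchanges the two types of a layer shell (`preimage_reflection_layerShell`), and preserves packings
and patterns.  `layers_down` is `layers_up` for `{x | R x ∈ V}` read back in `V`.

All statements are elementary ([folklore]).
-/

noncomputable section

namespace Summit.AtomisticToContinuum.Crystallization.Theorems

open Literature.Geometry.DiscreteGeometry Literature.MathematicalPhysics.StatisticalMechanics
open RealInnerProductSpace

/-! ### The reflection in the base plane -/

/-- The reflection of `ℝ³` in the horizontal plane `(ℝ 𝗁e₃)ᗮ`. [folklore] -/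
theorem baseReflection_frameE :
    ((ℝ ∙ (layerNormal layerSpacing : EuclideanSpace ℝ (Fin 3)))ᗮ).reflection (layerNormal layerSpacing) =
      -layerNormal layerSpacing :=
  Submodule.reflection_orthogonalComplement_singleton_eq_neg _

/-- Horizontal vectors are fixed by the reflection. [folklore] -/
theorem baseReflection_of_apply_two {x : EuclideanSpace ℝ (Fin 3)} (hx : x 2 = 0) :
    ((ℝ ∙ (layerNormal layerSpacing : EuclideanSpace ℝ (Fin 3)))ᗮ).reflection x = x := by
  apply Submodule.reflection_mem_subspace_eq_self
  rw [Submodule.mem_orthogonal_singleton_iff_inner_left, inner_fin3, hx]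
  simp

/-- The reflection on a vector split into horizontal and vertical parts. [folklore] -/
theorem baseReflection_add_smul {x : EuclideanSpace ℝ (Fin 3)} (hx : x 2 = 0) (a : ℝ) :
    ((ℝ ∙ (layerNormal layerSpacing : EuclideanSpace ℝ (Fin 3)))ᗮ).reflection (x + a • layerNormal layerSpacing) =
      x - a • layerNormal layerSpacing := by
  rw [map_add, map_smul, baseReflection_of_apply_two hx, baseReflection_frameE, smul_neg, sub_eq_add_neg]

/-- Every vector splits into a horizontal part and a multiple of `𝗁e₃`. [folklore] -/
theorem eq_horizontal_add_smul_frameE (y : EuclideanSpace ℝ (Fin 3)) :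
    y = (y - (y 2 / layerSpacing) • layerNormal layerSpacing) + (y 2 / layerSpacing) • layerNormal layerSpacing ∧
      (y - (y 2 / layerSpacing) • layerNormal layerSpacing) 2 = 0 := by
  refine ⟨by abel, ?_⟩
  have h := layerSpacing_pos.ne'
  simp [h]

/-- The reflection negates the height. [folklore] -/
theorem baseReflection_apply_two (y : EuclideanSpace ℝ (Fin 3)) :
    (((ℝ ∙ (layerNormal layerSpacing : EuclideanSpace ℝ (Fin 3)))ᗮ).reflection y) 2 = -y 2 := by
  obtain ⟨hy, h0⟩ := eq_horizontal_add_smul_frameE y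
  conv_lhs => rw [hy]
  rw [baseReflection_add_smul h0]
  have h := layerSpacing_pos.ne'
  simp only [PiLp.sub_apply, PiLp.smul_apply, smul_eq_mul, frameE_apply_two, h0]
  field_simp
  ring

/-- The reflection is an involution. [folklore] -/
theorem baseReflection_baseReflection (y : EuclideanSpace ℝ (Fin 3)) :
    ((ℝ ∙ (layerNormal layerSpacing : EuclideanSpace ℝ (Fin 3)))ᗮ).reflection
      (((ℝ ∙ (layerNormal layerSpacing : EuclideanSpace ℝ (Fin 3)))ᗮ).reflection y) = y :=
  Submodule.reflection_reflection _ _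

/-- A set of horizontal vectors is its own preimage under the reflection. [folklore] -/
theorem preimage_baseReflection_of_horizontal {A : Set (EuclideanSpace ℝ (Fin 3))}
    (hA : ∀ a ∈ A, a 2 = 0) :
    ((ℝ ∙ (layerNormal layerSpacing : EuclideanSpace ℝ (Fin 3)))ᗮ).reflection ⁻¹' A = A := by
  ext x
  simp only [Set.mem_preimage]
  constructor
  · intro h
    have e := baseReflection_of_apply_two (hA _ h)
    rw [baseReflection_baseReflection] at e
    -- `e : x = R x`
    rw [e]; exact h
  · intro h
    rw [baseReflection_of_apply_two (hA _ h)]; exact h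

/-- The reflection exchanges the lifted and the lowered copies of a set of horizontal vectors.
[folklore] -/
theorem preimage_baseReflection_image_add {A : Set (EuclideanSpace ℝ (Fin 3))} (hA : ∀ a ∈ A, a 2 = 0) :
    ((ℝ ∙ (layerNormal layerSpacing : EuclideanSpace ℝ (Fin 3)))ᗮ).reflection ⁻¹'
      ((fun t => t + layerNormal layerSpacing) '' A) = (fun t => t - layerNormal layerSpacing) '' A := by
  ext x
  simp only [Set.mem_preimage, mem_image_add_right_iff, mem_image_sub_right_iff]
  have key : ((ℝ ∙ (layerNormal layerSpacing : EuclideanSpace ℝ (Fin 3)))ᗮ).reflection x -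
      layerNormal layerSpacing =
      ((ℝ ∙ (layerNormal layerSpacing : EuclideanSpace ℝ (Fin 3)))ᗮ).reflection (x + layerNormal layerSpacing) := by
    rw [map_add, baseReflection_frameE, sub_eq_add_neg]
  rw [key]
  constructor
  · intro h
    have e := baseReflection_of_apply_two (hA _ h)
    rw [baseReflection_baseReflection] at e
    rw [e]; exact h
  · intro h
    rw [baseReflection_of_apply_two (hA _ h)]; exact h

/-- The reflection exchanges the lowered and the lifted copies of a set of horizontal vectors.
[folklore] -/
theorem preimage_baseReflection_image_sub {A : Set (EuclideanSpace ℝ (Fin 3))} (hA : ∀ a ∈ A, a 2 = 0) :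
    ((ℝ ∙ (layerNormal layerSpacing : EuclideanSpace ℝ (Fin 3)))ᗮ).reflection ⁻¹'
      ((fun t => t - layerNormal layerSpacing) '' A) = (fun t => t + layerNormal layerSpacing) '' A := by
  ext x
  simp only [Set.mem_preimage, mem_image_add_right_iff, mem_image_sub_right_iff]
  have key : ((ℝ ∙ (layerNormal layerSpacing : EuclideanSpace ℝ (Fin 3)))ᗮ).reflection x +
      layerNormal layerSpacing =
      ((ℝ ∙ (layerNormal layerSpacing : EuclideanSpace ℝ (Fin 3)))ᗮ).reflection (x - layerNormal layerSpacing) := by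
    rw [map_sub, baseReflection_frameE, sub_neg_eq_add]
  rw [key]
  constructor
  · intro h
    have e := baseReflection_of_apply_two (hA _ h)
    rw [baseReflection_baseReflection] at e
    rw [e]; exact h
  · intro h
    rw [baseReflection_of_apply_two (hA _ h)]; exact h

/-- **The reflection exchanges the two types of a layer shell**:
`R ⁻¹' layerShell σ σ′ = layerShell σ′ σ`. [folklore] -/
theorem preimage_baseReflection_layerShell (σ σ' : ℝ) :
    ((ℝ ∙ (layerNormal layerSpacing : EuclideanSpace ℝ (Fin 3)))ᗮ).reflection ⁻¹' layerShell σ σ' =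
      layerShell σ' σ := by
  rw [layerShell, layerShell, Set.preimage_union, Set.preimage_union,
    preimage_baseReflection_of_horizontal (fun a ha => apply_two_of_mem_hexagonSet ha),
    preimage_baseReflection_image_add (fun a ha => apply_two_of_mem_holeTriple ha),
    preimage_baseReflection_image_sub (fun a ha => apply_two_of_mem_holeTriple ha)]
  ext x; simp only [Set.mem_union]; tauto

/-- Double preimage under the involution. [folklore] -/
theorem preimage_baseReflection_preimage (K : Set (EuclideanSpace ℝ (Fin 3))) :
    ((ℝ ∙ (layerNormal layerSpacing : EuclideanSpace ℝ (Fin 3)))ᗮ).reflection ⁻¹'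
      (((ℝ ∙ (layerNormal layerSpacing : EuclideanSpace ℝ (Fin 3)))ᗮ).reflection ⁻¹' K) = K := by
  ext x
  show ((ℝ ∙ (layerNormal layerSpacing : EuclideanSpace ℝ (Fin 3)))ᗮ).reflection
      (((ℝ ∙ (layerNormal layerSpacing : EuclideanSpace ℝ (Fin 3)))ᗮ).reflection x) ∈ K ↔ x ∈ K
  rw [baseReflection_baseReflection]

/-! ### The reflected packing -/

section Reflected

variable {V : Set (EuclideanSpace ℝ (Fin 3))}

/-- Shells of the reflected packing. [folklore] -/
theorem kissingShell_reflected (y : EuclideanSpace ℝ (Fin 3)) :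
    kissingShell {x | ((ℝ ∙ (layerNormal layerSpacing : EuclideanSpace ℝ (Fin 3)))ᗮ).reflection x ∈ V} y =
      ((ℝ ∙ (layerNormal layerSpacing : EuclideanSpace ℝ (Fin 3)))ᗮ).reflection ⁻¹'
        kissingShell V (((ℝ ∙ (layerNormal layerSpacing : EuclideanSpace ℝ (Fin 3)))ᗮ).reflection y) := by
  ext x
  simp only [kissingShell, Set.mem_setOf_eq, Set.mem_preimage, map_add, LinearIsometryEquiv.norm_map]

/-- The reflected packing is a packing. [folklore] -/
theorem isUnitBallPacking_reflected (hV : IsUnitBallPacking V) :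
    IsUnitBallPacking {x | ((ℝ ∙ (layerNormal layerSpacing : EuclideanSpace ℝ (Fin 3)))ᗮ).reflection x ∈ V} := by
  intro x hx y hy hxy
  have h := hV hx hy (by rwa [LinearIsometryEquiv.dist_map])
  exact ((ℝ ∙ (layerNormal layerSpacing : EuclideanSpace ℝ (Fin 3)))ᗮ).reflection.injective h

/-- Patterns pass to the reflected packing. [folklore] -/
theorem isArrangedIn_reflected {P : Finset (EuclideanSpace ℝ (Fin 3))} {y : EuclideanSpace ℝ (Fin 3)}
    (h : IsArrangedIn (kissingShell V (((ℝ ∙ (layerNormal layerSpacing : EuclideanSpace ℝ (Fin 3)))ᗮ).reflection y)) P) :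
    IsArrangedIn (kissingShell {x | ((ℝ ∙ (layerNormal layerSpacing : EuclideanSpace ℝ (Fin 3)))ᗮ).reflection x ∈ V} y) P := by
  rw [kissingShell_reflected]; exact h.preimage _

end Reflected

/-! ### The layers below a certified base disc -/

section Layers

variable {V : Set (EuclideanSpace ℝ (Fin 3))}

/-- **All the layers below a certified base disc** (`layers_up` for the reflected packing): with
the same radii and real-arithmetic hypotheses, the pattern and zone hypotheses now on the
cylinder pieces BELOW the base, there is a sign sequence `s` (`s 0 = σ₀′`, the type of the base
shell below) such that layer `−(n+1)` is `ℤu₁ + ℤu₂ + (s 0 + ⋯ + s n) w − (n+1) 𝗁e₃` and each of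
its points within `ρ (n+1)` of the axis is a centre with shell `layerShell (−s n) (s (n+1))`.
[cite: HalesDSP2012, §1.3] -/
theorem layers_down (hV : IsUnitBallPacking V) {c : EuclideanSpace ℝ (Fin 3)} (hc : c 2 = 0)
    (good zone : EuclideanSpace ℝ (Fin 3) → Prop)
    (hgood : ∀ y ∈ V, good y →
      IsArrangedIn (kissingShell V y) fccKissingPattern ∨ IsArrangedIn (kissingShell V y) hcpKissingPattern)
    (hzone : ∀ y ∈ V, zone y → IsArrangedIn (kissingShell V y) fccKissingPattern)
    (N : ℕ) (ρ R : ℕ → ℝ) (hρ : ∀ n ≤ N, Real.sqrt 2 ≤ ρ n)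
    (hR : ∀ n < N, ∀ r : ℝ, ρ n < r → r ≤ R n →
      ∃ t : ℝ, 0 < t ∧ 4 / 3 * t ^ 2 < r ^ 2 ∧ r ^ 2 - (4 * t - 4) ≤ ρ n ^ 2)
    (hpar : ∀ n < N, ∀ r M : ℝ, 0 ≤ r → r ≤ ρ (n + 1) → 0 ≤ M → r ^ 2 ≤ 3 * M ^ 2 →
      r ^ 2 - 2 * M + 4 / 3 ≤ ρ n ^ 2)
    (hgoodρ : ∀ n < N, ∀ y ∈ V, y 2 = -(((n : ℝ) + 1) * layerSpacing) →
      ‖y - (c - ((n : ℝ) + 1) • layerNormal layerSpacing)‖ ≤ ρ (n + 1) → good y)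
    (hzoneρ : ∀ n < N, (∀ y ∈ V, y 2 = -(((n : ℝ) + 1) * layerSpacing) →
      ‖y - (c - ((n : ℝ) + 1) • layerNormal layerSpacing)‖ ≤ ρ (n + 1) → zone y) ∨
      ρ (n + 1) + 4 / Real.sqrt 3 ≤ R n)
    {σ₀ σ₀' : ℝ} (hσ₀' : σ₀' = 1 ∨ σ₀' = -1) {i₀ j₀ : ℤ}
    (h₀c : ‖((i₀ : ℝ) • (triangularVec₁ 2 : EuclideanSpace ℝ (Fin 3)) + (j₀ : ℝ) • triangularVec₂ 2) - c‖ ^ 2 ≤ 2)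
    (hbase : ∀ i j : ℤ,
      ‖((i : ℝ) • (triangularVec₁ 2 : EuclideanSpace ℝ (Fin 3)) + (j : ℝ) • triangularVec₂ 2) - c‖ ≤ ρ 0 →
      (i : ℝ) • (triangularVec₁ 2 : EuclideanSpace ℝ (Fin 3)) + (j : ℝ) • triangularVec₂ 2 ∈ V ∧
      kissingShell V ((i : ℝ) • (triangularVec₁ 2 : EuclideanSpace ℝ (Fin 3)) + (j : ℝ) • triangularVec₂ 2)
        = layerShell σ₀ σ₀') :
    ∃ s : ℕ → ℝ, s 0 = σ₀' ∧ (∀ n, s n = 1 ∨ s n = -1) ∧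
      ∀ n < N, ∀ i j : ℤ,
        ‖((i : ℝ) • (triangularVec₁ 2 : EuclideanSpace ℝ (Fin 3)) + (j : ℝ) • triangularVec₂ 2 +
            (∑ m ∈ Finset.range (n + 1), s m) • barlowOffset 2) - c‖ ≤ ρ (n + 1) →
        (i : ℝ) • (triangularVec₁ 2 : EuclideanSpace ℝ (Fin 3)) + (j : ℝ) • triangularVec₂ 2 +
            (∑ m ∈ Finset.range (n + 1), s m) • barlowOffset 2 -
            ((n : ℝ) + 1) • layerNormal layerSpacing ∈ V ∧
        kissingShell V ((i : ℝ) • (triangularVec₁ 2 : EuclideanSpace ℝ (Fin 3)) + (j : ℝ) • triangularVec₂ 2 +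
            (∑ m ∈ Finset.range (n + 1), s m) • barlowOffset 2 -
            ((n : ℝ) + 1) • layerNormal layerSpacing) = layerShell (-(s n)) (s (n + 1)) := by
  set Rf := ((ℝ ∙ (layerNormal layerSpacing : EuclideanSpace ℝ (Fin 3)))ᗮ).reflection with hRf
  set V' : Set (EuclideanSpace ℝ (Fin 3)) := {x | Rf x ∈ V} with hV'
  have hVp : IsUnitBallPacking V' := isUnitBallPacking_reflected hV
  have lat2 : ∀ i j : ℤ,
      ((i : ℝ) • (triangularVec₁ 2 : EuclideanSpace ℝ (Fin 3)) + (j : ℝ) • triangularVec₂ 2) 2 = 0 :=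
    fun i j => by simp
  have hw2 : (barlowOffset 2 : EuclideanSpace ℝ (Fin 3)) 2 = 0 := frameW_apply_two
  -- transport of a point of a cylinder piece
  have transp : ∀ (n : ℕ) (y : EuclideanSpace ℝ (Fin 3)), y 2 = ((n : ℝ) + 1) * layerSpacing →
      (Rf y) 2 = -(((n : ℝ) + 1) * layerSpacing) ∧
      ‖Rf y - (c - ((n : ℝ) + 1) • layerNormal layerSpacing)‖ =
        ‖y - (c + ((n : ℝ) + 1) • layerNormal layerSpacing)‖ := by
    intro n y hy
    refine ⟨by rw [baseReflection_apply_two, hy], ?_⟩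
    have e : Rf y - (c - ((n : ℝ) + 1) • layerNormal layerSpacing) =
        Rf (y - (c + ((n : ℝ) + 1) • layerNormal layerSpacing)) := by
      rw [map_sub, baseReflection_add_smul hc]
    rw [e, LinearIsometryEquiv.norm_map]
  obtain ⟨s, s0, hs, hA⟩ := layers_up hVp hc (fun y => good (Rf y)) (fun y => zone (Rf y))
    (fun y hy hg => by
      rcases hgood (Rf y) hy hg with h | h
      · exact Or.inl (isArrangedIn_reflected h)
      · exact Or.inr (isArrangedIn_reflected h))
    (fun y hy hz => isArrangedIn_reflected (hzone (Rf y) hy hz))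
    N ρ R hρ hR hpar
    (fun n hn y hy h2 hd => by
      obtain ⟨h2', hd'⟩ := transp n y h2
      exact hgoodρ n hn (Rf y) hy h2' (by rw [hd']; exact hd))
    (fun n hn => by
      rcases hzoneρ n hn with hz | hz
      · left
        intro y hy h2 hd
        obtain ⟨h2', hd'⟩ := transp n y h2
        exact hz (Rf y) hy h2' (by rw [hd']; exact hd)
      · exact Or.inr hz)
    hσ₀' (σ₀' := σ₀) h₀c
    (fun i j hij => by
      obtain ⟨hm, hsh⟩ := hbase i j hij
      refine ⟨?_, ?_⟩
      · show Rf _ ∈ V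
        rw [baseReflection_of_apply_two (lat2 i j)]; exact hm
      · rw [kissingShell_reflected, baseReflection_of_apply_two (lat2 i j), hsh,
          preimage_baseReflection_layerShell])
  refine ⟨s, s0, hs, fun n hn i j hij => ?_⟩
  obtain ⟨hm, hsh⟩ := hA n hn i j hij
  have hor : ((i : ℝ) • (triangularVec₁ 2 : EuclideanSpace ℝ (Fin 3)) + (j : ℝ) • triangularVec₂ 2 +
      (∑ m ∈ Finset.range (n + 1), s m) • barlowOffset 2) 2 = 0 := by
    simp [hw2]
  have e : Rf ((i : ℝ) • (triangularVec₁ 2 : EuclideanSpace ℝ (Fin 3)) + (j : ℝ) • triangularVec₂ 2 +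
      (∑ m ∈ Finset.range (n + 1), s m) • barlowOffset 2 + ((n : ℝ) + 1) • layerNormal layerSpacing) =
      (i : ℝ) • (triangularVec₁ 2 : EuclideanSpace ℝ (Fin 3)) + (j : ℝ) • triangularVec₂ 2 +
      (∑ m ∈ Finset.range (n + 1), s m) • barlowOffset 2 - ((n : ℝ) + 1) • layerNormal layerSpacing :=
    baseReflection_add_smul hor _
  refine ⟨by rw [← e]; exact hm, ?_⟩
  rw [kissingShell_reflected, e] at hsh
  have := congrArg (fun K => Rf ⁻¹' K) hsh
  simp only [hRf, preimage_baseReflection_preimage, preimage_baseReflection_layerShell] at this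
  exact this

end Layers

/-- **Registered sub-goal `ballPropagation_reflectLayerShell`** of the crux item (the reflection exchanges the shell types, in closed form: `preimage_baseReflection_layerShell`). [folklore] -/
theorem ballPropagation_reflectLayerShell :
    ∀ (σ σ' : ℝ), ((ℝ ∙ (Literature.MathematicalPhysics.StatisticalMechanics.layerNormal
    Literature.Geometry.DiscreteGeometry.layerSpacing : EuclideanSpace ℝ (Fin 3)))ᗮ).reflection ⁻¹'
    Literature.Geometry.DiscreteGeometry.layerShell σ σ' =
    Literature.Geometry.DiscreteGeometry.layerShell σ' σ :=
  fun σ σ' => preimage_baseReflection_layerShell σ σ'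

end Summit.AtomisticToContinuum.Crystallization.Theorems

end
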